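import Literature.Analysis.FluidPDE.PressureDecayEstimateProofs
import Literature.Analysis.FluidPDE.RusinSverakBackwardRegularity
import Literature.Analysis.FluidPDE.CKNInnerCylinders
import Literature.Analysis.FluidPDE.BlowupLimitBounds
import Literature.Analysis.FluidPDE.LocalTypeIReverseTools
import Literature.Analysis.FluidPDE.CKNOneScaleOscillation
import HarnessLib

/-!
# The plain scaled pressure quantity `D` is bounded at all sub-apices from a bound on `C` at all
# sub-balls and on `D` at one scale; transfer to a blow-up limit at every apex (local centres,
# general scales)

Analysis/FluidPDE proofs-only file (theorems only: no definition, no named fact; nothing accepted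
is restated or changed). Two bookkeeping theorems around the **plain** scaled pressure quantity
`D(r; z) = r⁻² ∫_{Q_r(z)} |p|^{3/2}` (`cknD`, not mean-free) used as the hypothesis `hP` of the
tree's Escauriaza–Seregin–Šverák endgame `ancient_lintegral_cube_eq_zero_of_farField_le`
(`AncientLimitVanishingScaled.lean`), as opposed to the MEAN-FREE quantity `D_osc` (`cknDOsc`) that
enters Albritton–Barker's Type-I functional `𝐈 = sup (A + C + D_osc + E)` (`typeIBound`,
`LocalTypeI.lean`).

* `exists_cknD_le_of_cknC_le` — **Seregin–Šverák 2009, proof of Lemma 3.5, the decay estimate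
  (as13) "easily iterated"** (arXiv:0804.1803 p. 10; the same iteration is Seregin–Zajaczkowski
  2007, (2.8), and Rusin–Šverák 2011, proof of Lemma 2.1): there is a universal `κ` such that for a
  distributional solution `(u, p)` of the unit-viscosity unforced Navier–Stokes equations on an open
  `Q ⊇ Q_{r₀}(z₀)`, if `C(r; z) ≤ M₁` for every parabolic ball `Q_r(z) ⊆ Q_{r₀}(z₀)` and
  `D(r₀; z₀) ≤ M₂`, then `D(r; z) ≤ κ (M₁ + M₂)` for every `z` with `Q_{r₀/2}(z) ⊆ Q_{r₀}(z₀)` and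
  every `0 < r ≤ r₀/2`. Proof: `D(r₀/2; z) ≤ 4 D(r₀; z₀)` (inclusion, `cknD_le_mul_of_subset`);
  the proved decay estimate `seregin_sverak_pressure_decay_holds` at a ratio `θ` with `cθ ≤ 1/2`
  (`exists_ratio_mul_le_half`) iterated along `θʲ r₀/2` (`cknD_iterate_le_of_pressure_decay`) gives
  `D(θᴶ r₀/2; z) ≤ 2^{-J}·4M₂ + 2cθ⁻²M₁`; between two consecutive scales
  `D(r; z) ≤ θ⁻² D(θᴶ r₀/2; z)` (inclusion again). With the inputs gauge-free (`C`) or one-scale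
  (`D(r₀; z₀)`), this is how a bound `𝐈(Q_{r₀}(z₀)) ≤ M` (which controls `C` on every sub-ball and
  `D_osc`, hence `D` of the ball-mean–gauged pressure at the top scale — the tree's gauge identity
  `cknD_sub_ballMean` (`CKNOneScaleOscillation.lean`), packaged here as
  `cknD_sub_ballMean_le_of_typeIBound_le` / `cknC_le_of_typeIBound_le`) yields
  the plain-`D` bound the endgame wants, with `D₀ = κ' M`.
* `blowup_cknD_le_apex_of_tendsto` — **Wang–Zhang 2017, §4 Step 1, (4.3)–(4.4) for `D`**, the
  tree's `blowup_cknD_le_apex` (`BlowupLimitBounds.lean`) with two bookkeeping generalisations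
  needed by consumers of `Seregin2020.exists_ancientLimit`: an ARBITRARY sequence of scales
  `μ_j → 0⁺` (not only `2^{-(δ(j)+2)}`), and the hypothesis on the original pressure restricted to
  apices with spatial centre in the ball `B(x₀, ρ)` (the rescaled apices `Φ_{μ_j}(z)` have centres
  `x₀ + μ_j z.2 → x₀`). If `D(r; z) ≤ K` for the original pressure at every apex `z` with
  `t₀ - τ ≤ z.1 ≤ t₀`, `|z.2 - x₀| < ρ` and every `0 < r ≤ r₁`, and the rescaled pressures
  `μ_j² p ∘ Φ_{μ_j}` converge weakly in `L^{3/2}(Q(a))` to `π ∈ L^{3/2}(Q(a))` for every `a`, then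
  `D(r; z)[π] ≤ K` at every apex with `z.1 ≤ 0` and every `r > 0` (scale covariance `cknD_nsZoom`
  and the weak lower semicontinuity `setLIntegral_rpow_threeHalves_le_of_tendsto_weakly`);
  `blowup_cknD_le_apex_of_tendsto_of_radius` is the same with the a.e.-measurability of the
  original pressure asked only on `Q(z₀, ρ₀)` for some `ρ₀ > 0` (instead of `Q(z₀, 1/2)`), the form
  needed at an apex `(T, x₀)` of a solution living on `(0, T) × ℝ³` with `T` small.

## References

* G. Seregin, V. Šverák, Comm. PDE 34 (2009) = arXiv:0804.1803, proof of Lemma 3.5, (as13) and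
  "The latter inequality can be easily iterated" (p. 10). [SereginSverak2009]
* G. Seregin, W. Zajaczkowski, SIAM J. Math. Anal. 39 (2007) = arXiv:math/0702720, (2.8).
  [SereginZajaczkowski2007]
* W. Rusin, V. Šverák, J. Funct. Anal. 260 (2011) = arXiv:0911.0500, proof of Lemma 2.1.
  [RusinSverak2011]
* W. Wang, Z. Zhang, Sci. China Math. 60 (2017) = arXiv:1510.02589, §4 Step 1 (4.3)–(4.4).
  [WangZhang2016]
* G. Seregin, *Lecture notes on regularity theory for the Navier–Stokes equations* (2014), §6.6
  Prop. 6.20. [Seregin2014]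
-/

noncomputable section

open MeasureTheory Set Function Filter Topology TopologicalSpace Metric
open scoped NNReal ENNReal

namespace Literature.Analysis.FluidPDE

/-! ### Plain `D` at all sub-apices from `C` on sub-balls and `D` at one scale -/

section PlainD

/-- Dyadic localisation of a radius along the scales `θʲ s₀`: for `0 < θ < 1` and `0 < r ≤ s₀`
there is `J` with `θ^{J+1} s₀ < r ≤ θ^J s₀`. [folklore] -/
private theorem exists_pow_succ_mul_lt_le {θ s₀ r : ℝ} (hθ : 0 < θ) (hθ1 : θ < 1) (hs₀ : 0 < s₀)
    (hr : 0 < r) (hrs : r ≤ s₀) :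
    ∃ J : ℕ, θ ^ (J + 1) * s₀ < r ∧ r ≤ θ ^ J * s₀ := by
  have hx : 0 < r / s₀ := div_pos hr hs₀
  have hx1 : r / s₀ ≤ 1 := (div_le_one hs₀).2 hrs
  obtain ⟨J, h1, h2⟩ := exists_nat_pow_near_of_lt_one hx hx1 hθ hθ1
  refine ⟨J, ?_, ?_⟩
  · have := (lt_div_iff₀ hs₀).1 h1
    linarith
  · have := (div_le_iff₀ hs₀).1 h2
    linarith

/-- **Plain `D` bounded at all sub-apices and all small radii** (Seregin–Šverák 2009, proof of
Lemma 3.5: the decay estimate (as13) `D(ϱ) ≤ c[(ϱ/r) D(r) + (r/ϱ)² C(r)]` "can be easily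
iterated", arXiv p. 10; Seregin–Zajaczkowski 2007 (2.8); Rusin–Šverák 2011, proof of Lemma 2.1).
There is a universal constant `κ` such that: for every distributional solution `(u, p)` of the
unforced unit-viscosity Navier–Stokes equations on an open `Q`, every parabolic ball
`Q_{r₀}(z₀) ⊆ Q`, and all `M₁, M₂ ∈ [0, ∞]`, if `C(r; z) ≤ M₁` for every `Q_r(z) ⊆ Q_{r₀}(z₀)`
(`r > 0`) and `D(r₀; z₀) ≤ M₂` (plain `D = cknD`), then `D(r; z) ≤ κ (M₁ + M₂)` for every apex `z`
with `Q_{r₀/2}(z) ⊆ Q_{r₀}(z₀)` and every `0 < r ≤ r₀/2`. (Inputs from the tree: the decay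
estimate is the PROVED `seregin_sverak_pressure_decay_holds`, iterated by
`cknD_iterate_le_of_pressure_decay` at a ratio `θ` with `cθ ≤ ½`; inclusions by
`cknD_le_mul_of_subset`; `κ = θ⁻²(4 + 2cθ⁻²)`.)
[cite: SereginSverak2009, proof of Lemma 3.5, (as13) and its iteration (arXiv:0804.1803 p. 10)]
[cite: SereginZajaczkowski2007, (2.8)] -/
theorem exists_cknD_le_of_cknC_le :
    ∃ κ : ℝ≥0, ∀ (Q : Opens (ℝ × EuclideanSpace ℝ (Fin 3)))
      (u : ℝ → EuclideanSpace ℝ (Fin 3) → EuclideanSpace ℝ (Fin 3))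
      (p : ℝ → EuclideanSpace ℝ (Fin 3) → ℝ),
      IsDistributionalNSSolutionOn Q 1 0 u p →
      ∀ (z₀ : ℝ × EuclideanSpace ℝ (Fin 3)) (r₀ : ℝ), 0 < r₀ →
        parabolicCylinder r₀ z₀ ⊆ (Q : Set (ℝ × EuclideanSpace ℝ (Fin 3))) →
        ∀ (M₁ M₂ : ℝ≥0∞),
          (∀ (z : ℝ × EuclideanSpace ℝ (Fin 3)) (r : ℝ), 0 < r →
            parabolicCylinder r z ⊆ parabolicCylinder r₀ z₀ → cknC r z u ≤ M₁) →
          cknD r₀ z₀ p ≤ M₂ →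
          ∀ z : ℝ × EuclideanSpace ℝ (Fin 3),
            parabolicCylinder (r₀ / 2) z ⊆ parabolicCylinder r₀ z₀ →
            ∀ r ∈ Ioc (0 : ℝ) (r₀ / 2), cknD r z p ≤ κ * (M₁ + M₂) := by
  -- the constant of the decay estimate and a ratio absorbing it
  obtain ⟨c, hc⟩ := seregin_sverak_pressure_decay_holds.ratio
  obtain ⟨θ, hθ, hθhalf, hcθ⟩ := exists_ratio_mul_le_half c
  have hθ1 : θ ≤ 1 := hθhalf.trans (by norm_num)
  have hθlt1 : θ < 1 := hθhalf.trans_lt (by norm_num)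
  -- `Θ = θ⁻²` as a non-negative real; `κ = Θ (4 + 2 c Θ)`
  set Θ : ℝ≥0 := (θ⁻¹ ^ 2).toNNReal with hΘ
  have hΘcoe : (Θ : ℝ≥0∞) = ENNReal.ofReal (θ⁻¹ ^ 2) := rfl
  refine ⟨Θ * (4 + 2 * c * Θ), fun Q u p hdist z₀ r₀ hr₀ hQ M₁ M₂ hC hD z hz r hr => ?_⟩
  have hs₀ : 0 < r₀ / 2 := half_pos hr₀
  -- `Q_{r₀/2}(z) ⊆ Q`
  have hzQ : parabolicCylinder (r₀ / 2) z ⊆ (Q : Set (ℝ × EuclideanSpace ℝ (Fin 3))) :=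
    hz.trans hQ
  -- Step 1: `D(r₀/2; z) ≤ 4 D(r₀; z₀) ≤ 4 M₂`
  have hD₀ : cknD (r₀ / 2) z p ≤ 4 * M₂ := by
    have h1 := cknD_le_mul_of_subset hr₀ hs₀ hz p
    have e : ENNReal.ofReal (r₀ / (r₀ / 2)) ^ 2 = 4 := by
      rw [show r₀ / (r₀ / 2) = (2 : ℝ) by field_simp, ENNReal.ofReal_ofNat]; norm_num
    rw [e] at h1
    exact h1.trans (mul_le_mul' le_rfl hD)
  -- Step 2: the iteration along `θʲ r₀/2`
  have hiter : ∀ J : ℕ, cknD (θ ^ J * (r₀ / 2)) z p ≤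
      4 * M₂ + 2 * (c * ENNReal.ofReal ((θ⁻¹) ^ 2) * M₁) := by
    intro J
    have hCj : ∀ j < J, cknC (θ ^ j * (r₀ / 2)) z u ≤ M₁ := by
      intro j _
      have hj0 : 0 < θ ^ j * (r₀ / 2) := by positivity
      have hjle : θ ^ j * (r₀ / 2) ≤ r₀ / 2 :=
        mul_le_of_le_one_left hs₀.le (pow_le_one₀ hθ.le hθ1)
      exact hC _ _ hj0 ((parabolicCylinder_mono hj0.le hjle z).trans hz)
    have h := cknD_iterate_le_of_pressure_decay hc hθ hθ1 hcθ hdist hs₀ hzQ (e := M₁) (J := J) hCj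
    have hle : (2⁻¹ : ℝ≥0∞) ^ J * cknD (r₀ / 2) z p ≤ 4 * M₂ :=
      calc (2⁻¹ : ℝ≥0∞) ^ J * cknD (r₀ / 2) z p ≤ 1 * cknD (r₀ / 2) z p :=
            mul_le_mul' (pow_le_one₀ bot_le (by norm_num)) le_rfl
        _ ≤ 4 * M₂ := by rw [one_mul]; exact hD₀
    exact h.trans (add_le_add hle le_rfl)
  -- Step 3: localise `r` between two consecutive scales
  have hr0 : 0 < r := hr.1
  obtain ⟨J, hJlt, hJle⟩ := exists_pow_succ_mul_lt_le hθ hθlt1 hs₀ hr0 hr.2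
  have hsJ : 0 < θ ^ J * (r₀ / 2) := by positivity
  have hincl : parabolicCylinder r z ⊆ parabolicCylinder (θ ^ J * (r₀ / 2)) z :=
    parabolicCylinder_mono hr0.le hJle z
  have h1 := cknD_le_mul_of_subset hsJ hr0 hincl p
  -- the ratio of the two scales is at most `θ⁻¹`
  have hratio : ENNReal.ofReal (θ ^ J * (r₀ / 2) / r) ^ 2 ≤ (Θ : ℝ≥0∞) := by
    rw [hΘcoe, ← ENNReal.ofReal_pow (by positivity)]
    refine ENNReal.ofReal_le_ofReal ?_
    have hq : θ ^ J * (r₀ / 2) / r ≤ θ⁻¹ := by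
      rw [div_le_iff₀ hr0, inv_eq_one_div, div_mul_eq_mul_div, one_mul, le_div_iff₀ hθ]
      calc θ ^ J * (r₀ / 2) * θ = θ ^ (J + 1) * (r₀ / 2) := by ring
        _ ≤ r := hJlt.le
    exact pow_le_pow_left₀ (by positivity) hq 2
  calc cknD r z p ≤ ENNReal.ofReal (θ ^ J * (r₀ / 2) / r) ^ 2 * cknD (θ ^ J * (r₀ / 2)) z p := h1
    _ ≤ (Θ : ℝ≥0∞) * (4 * M₂ + 2 * (c * ENNReal.ofReal ((θ⁻¹) ^ 2) * M₁)) :=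
        mul_le_mul' hratio (hiter J)
    _ = (Θ : ℝ≥0∞) * (4 * M₂ + 2 * ((c : ℝ≥0∞) * Θ * M₁)) := by rw [hΘcoe]
    _ ≤ (Θ : ℝ≥0∞) * (4 * (M₁ + M₂) + 2 * ((c : ℝ≥0∞) * Θ * (M₁ + M₂))) := by
        gcongr
        · exact le_add_self
        · exact le_self_add
    _ = ((Θ * (4 + 2 * c * Θ) : ℝ≥0) : ℝ≥0∞) * (M₁ + M₂) := by
        push_cast
        ring

/-- Half-cylinders in window form: if `z.1 ≤ z₀.1`, `z₀.1 - 3r₀²/4 ≤ z.1` and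
`|z.2 - z₀.2| ≤ r₀/2`, then `Q_{r₀/2}(z) ⊆ Q_{r₀}(z₀)`. [folklore] -/
private theorem parabolicCylinder_half_subset_of_window {z₀ z : ℝ × EuclideanSpace ℝ (Fin 3)} {r₀ : ℝ}
    (h1 : z.1 ≤ z₀.1) (h2 : z₀.1 - 3 * r₀ ^ 2 / 4 ≤ z.1) (h3 : dist z.2 z₀.2 ≤ r₀ / 2) :
    parabolicCylinder (r₀ / 2) z ⊆ parabolicCylinder r₀ z₀ := by
  intro w hw
  rw [mem_parabolicCylinder] at hw ⊢
  obtain ⟨⟨hw1, hw2⟩, hw3⟩ := hw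
  refine ⟨⟨by nlinarith, hw2.trans_le h1⟩, ?_⟩
  calc dist w.2 z₀.2 ≤ dist w.2 z.2 + dist z.2 z₀.2 := dist_triangle _ _ _
    _ < r₀ / 2 + r₀ / 2 := add_lt_add_of_lt_of_le hw3 h3
    _ = r₀ := by ring

/-- **Plain `D` bounded in a backward window around the apex** — `exists_cknD_le_of_cknC_le` in
the window form consumed by `blowup_cknD_le_apex_of_tendsto` (`τ = 3r₀²/4`, `ρ = r₁ = r₀/2`):
under the same hypotheses, `D(r; z) ≤ κ (M₁ + M₂)` for every apex `z` with
`z₀.1 - 3r₀²/4 ≤ z.1 ≤ z₀.1`, `|z.2 - z₀.2| < r₀/2` and every `0 < r ≤ r₀/2`.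
[cite: SereginSverak2009, proof of Lemma 3.5, (as13) and its iteration (arXiv:0804.1803 p. 10)] -/
theorem exists_cknD_le_window_of_cknC_le :
    ∃ κ : ℝ≥0, ∀ (Q : Opens (ℝ × EuclideanSpace ℝ (Fin 3)))
      (u : ℝ → EuclideanSpace ℝ (Fin 3) → EuclideanSpace ℝ (Fin 3))
      (p : ℝ → EuclideanSpace ℝ (Fin 3) → ℝ),
      IsDistributionalNSSolutionOn Q 1 0 u p →
      ∀ (z₀ : ℝ × EuclideanSpace ℝ (Fin 3)) (r₀ : ℝ), 0 < r₀ →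
        parabolicCylinder r₀ z₀ ⊆ (Q : Set (ℝ × EuclideanSpace ℝ (Fin 3))) →
        ∀ (M₁ M₂ : ℝ≥0∞),
          (∀ (z : ℝ × EuclideanSpace ℝ (Fin 3)) (r : ℝ), 0 < r →
            parabolicCylinder r z ⊆ parabolicCylinder r₀ z₀ → cknC r z u ≤ M₁) →
          cknD r₀ z₀ p ≤ M₂ →
          ∀ z : ℝ × EuclideanSpace ℝ (Fin 3), z.1 ≤ z₀.1 → z₀.1 - 3 * r₀ ^ 2 / 4 ≤ z.1 →
            dist z.2 z₀.2 < r₀ / 2 →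
            ∀ r ∈ Ioc (0 : ℝ) (r₀ / 2), cknD r z p ≤ κ * (M₁ + M₂) := by
  obtain ⟨κ, hκ⟩ := exists_cknD_le_of_cknC_le
  exact ⟨κ, fun Q u p hdist z₀ r₀ hr₀ hQ M₁ M₂ hC hD z h1 h2 h3 r hr =>
    hκ Q u p hdist z₀ r₀ hr₀ hQ M₁ M₂ hC hD z
      (parabolicCylinder_half_subset_of_window h1 h2 h3.le) r hr⟩

/-- The one-scale input in the ball-mean gauge from Albritton–Barker's functional: if
`𝐈(ω) ≤ M` and `Q_{r₀}(z₀) ⊆ ω` (`r₀ > 0`), then `D(r₀; z₀)[p − ⨍_{B(z₀.2, r₀)} p(t, ·)] ≤ M`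
(any `G`): `D(Q') ≤ A + C + D + E ≤ 𝐈(ω)` for `Q' ⊆ ω` (Albritton–Barker 2019, §1, the display
defining `𝐈(ω) = sup_{Q' ⊆ ω} …`). [cite: AlbrittonBarker2019, §1 (display defining 𝐈(ω) after Thm 1.1)] -/
theorem cknD_sub_ballMean_le_of_typeIBound_le {ω : Set (ℝ × EuclideanSpace ℝ (Fin 3))}
    {u : ℝ → EuclideanSpace ℝ (Fin 3) → EuclideanSpace ℝ (Fin 3)}
    {p : ℝ → EuclideanSpace ℝ (Fin 3) → ℝ}
    {G : ℝ → EuclideanSpace ℝ (Fin 3) → EuclideanSpace ℝ (Fin 3) →L[ℝ] EuclideanSpace ℝ (Fin 3)}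
    {M : ℝ≥0∞} (hI : typeIBound ω u p G ≤ M) {z₀ : ℝ × EuclideanSpace ℝ (Fin 3)} {r₀ : ℝ}
    (hr₀ : 0 < r₀) (hω : parabolicCylinder r₀ z₀ ⊆ ω) :
    cknD r₀ z₀ (fun t x => p t x - ⨍ y in ball z₀.2 r₀, p t y) ≤ M := by
  rw [cknD_sub_ballMean]
  exact (cknDOsc_le_abScaledSum.trans (abScaledSum_le_typeIBound hr₀ hω)).trans hI

/-- The gauge-free input from Albritton–Barker's functional: if `𝐈(ω) ≤ M` and
`Q_{r₀}(z₀) ⊆ ω`, then `C(r; z) ≤ M` for every `Q_r(z) ⊆ Q_{r₀}(z₀)`, `r > 0` (any `p`, `G`):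
`C(Q') ≤ A + C + D + E ≤ 𝐈(ω)` for `Q' ⊆ ω` (Albritton–Barker 2019, §1, the display defining
`𝐈(ω)`). [cite: AlbrittonBarker2019, §1 (display defining 𝐈(ω) after Thm 1.1)] -/
theorem cknC_le_of_typeIBound_le {ω : Set (ℝ × EuclideanSpace ℝ (Fin 3))}
    {u : ℝ → EuclideanSpace ℝ (Fin 3) → EuclideanSpace ℝ (Fin 3)}
    {p : ℝ → EuclideanSpace ℝ (Fin 3) → ℝ}
    {G : ℝ → EuclideanSpace ℝ (Fin 3) → EuclideanSpace ℝ (Fin 3) →L[ℝ] EuclideanSpace ℝ (Fin 3)}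
    {M : ℝ≥0∞} (hI : typeIBound ω u p G ≤ M) {z₀ : ℝ × EuclideanSpace ℝ (Fin 3)} {r₀ : ℝ}
    (hω : parabolicCylinder r₀ z₀ ⊆ ω) {z : ℝ × EuclideanSpace ℝ (Fin 3)} {r : ℝ} (hr : 0 < r)
    (hz : parabolicCylinder r z ⊆ parabolicCylinder r₀ z₀) :
    cknC r z u ≤ M :=
  ((cknC_le_abScaledSum (p := p) (G := G)).trans (abScaledSum_le_typeIBound hr (hz.trans hω))).trans hI

end PlainD

/-! ### `D` of a blow-up limit at every apex: general scales, local centres -/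

section Apex

variable {p : ℝ → EuclideanSpace ℝ (Fin 3) → ℝ}

/-- **Apices, centres and radii of the rescaled cylinders**: for `z.1 ≤ 0` and `μ_j → 0`,
`μ_j > 0`, the apex `Φ_{μ_j}(z) = (t₀ + μ_j² z.1, x₀ + μ_j z.2)` of `Q_{μ_j r}(Φ_{μ_j} z)` lies in
the window `[t₀ - τ, t₀]`, its centre lies in `B(x₀, ρ)`, and the radius `μ_j r` is at most `r₁`,
for all large `j`. [folklore] -/
private theorem eventually_apex_mem_window_ball {z : ℝ × EuclideanSpace ℝ (Fin 3)} (hz : z.1 ≤ 0)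
    (r : ℝ) {τ r₁ ρ : ℝ} (hτ : 0 < τ) (hr₁ : 0 < r₁) (hρ : 0 < ρ) {μ : ℕ → ℝ}
    (hμ : ∀ j, 0 < μ j) (hμ0 : Tendsto μ atTop (𝓝 0)) (t₀ : ℝ)
    (x₀ : EuclideanSpace ℝ (Fin 3)) :
    ∃ j₁ : ℕ, ∀ j, j₁ ≤ j →
      (stAffine (μ j ^ 2) (μ j) t₀ x₀ z).1 ≤ t₀ ∧ t₀ - τ ≤ (stAffine (μ j ^ 2) (μ j) t₀ x₀ z).1 ∧
        dist (stAffine (μ j ^ 2) (μ j) t₀ x₀ z).2 x₀ < ρ ∧ μ j * r ≤ r₁ := by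
  obtain ⟨j₁, hj₁⟩ := eventually_apex_mem_window hz r hτ hr₁ hμ0 t₀ x₀
  have h3 : ∀ᶠ j in atTop, μ j * ‖z.2‖ < ρ := by
    have ht : Tendsto (fun j => μ j * ‖z.2‖) atTop (𝓝 (0 * ‖z.2‖)) := hμ0.mul_const _
    rw [zero_mul] at ht
    exact ht.eventually (gt_mem_nhds hρ)
  obtain ⟨j₂, hj₂⟩ := h3.exists_forall_of_atTop
  refine ⟨max j₁ j₂, fun j hj => ?_⟩
  obtain ⟨ha, hb, hd⟩ := hj₁ j (le_trans (le_max_left _ _) hj)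
  refine ⟨ha, hb, ?_, hd⟩
  rw [stAffine_snd, dist_eq_norm, add_sub_cancel_left, norm_smul, Real.norm_eq_abs,
    abs_of_pos (hμ j)]
  exact hj₂ j (le_trans (le_max_right _ _) hj)

/-- Along scales `μ_j → 0`, eventually `a μ_j ≤ ρ₀` (`ρ₀ > 0`). [folklore] -/
private theorem eventually_mul_scale_le {μ : ℕ → ℝ} (hμ0 : Tendsto μ atTop (𝓝 0))
    (a : ℝ) {ρ₀ : ℝ} (hρ₀ : 0 < ρ₀) :
    ∃ j₀ : ℕ, ∀ j, j₀ ≤ j → a * μ j ≤ ρ₀ := by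
  have ht : Tendsto (fun j => a * μ j) atTop (𝓝 (a * 0)) := hμ0.const_mul a
  rw [mul_zero] at ht
  exact (ht.eventually (ge_mem_nhds hρ₀)).exists_forall_of_atTop

/-- The rescaled pressure `μ² p ∘ Φ_μ` is a.e. strongly measurable on `Q(a)` as soon as
`aμ ≤ ρ₀`, if `p` is so on `Q(z₀, ρ₀)` (the tree's `aestronglyMeasurable_uncurry_zoom_pressure_of`
with `1/2` replaced by any `ρ₀`). [folklore] -/
private theorem aestronglyMeasurable_uncurry_zoom_pressure_of_radius
    {z₀ : ℝ × EuclideanSpace ℝ (Fin 3)} {ρ₀ : ℝ}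
    (hp : AEStronglyMeasurable (uncurry p) (volume.restrict (parabolicCylinder ρ₀ z₀)))
    {μ a : ℝ} (hμ : 0 < μ) (ha : 0 < a) (haμ : a * μ ≤ ρ₀) :
    AEStronglyMeasurable (uncurry (μ ^ 2 • stPull (μ ^ 2) μ z₀.1 z₀.2 p))
      (volume.restrict (parabolicCylinder a (0 : ℝ × EuclideanSpace ℝ (Fin 3)))) := by
  have hp' : AEStronglyMeasurable (uncurry p) (volume.restrict (parabolicCylinder (a * μ) z₀)) :=
    hp.mono_measure (Measure.restrict_mono
      (parabolicCylinder_mono (by positivity) haμ z₀) le_rfl)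
  have hpre : stAffine (μ ^ 2) μ z₀.1 z₀.2 ⁻¹' parabolicCylinder (a * μ) z₀ =
      parabolicCylinder a (0 : ℝ × EuclideanSpace ℝ (Fin 3)) := by
    rw [zoom_preimage_parabolicCylinder hμ, mul_div_cancel_right₀ a hμ.ne']
  have hcomp : AEStronglyMeasurable (uncurry p ∘ stAffine (μ ^ 2) μ z₀.1 z₀.2)
      (volume.restrict (parabolicCylinder a (0 : ℝ × EuclideanSpace ℝ (Fin 3)))) := by
    rw [← hpre]
    refine hp'.comp_quasiMeasurePreserving ⟨measurable_stAffine _ _ _ _, ?_⟩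
    rw [map_stAffine_volume_restrict_preimage (pow_pos hμ 2) hμ]
    exact Measure.smul_absolutelyContinuous
  have e : uncurry (μ ^ 2 • stPull (μ ^ 2) μ z₀.1 z₀.2 p) =
      (μ ^ 2) • (uncurry p ∘ stAffine (μ ^ 2) μ z₀.1 z₀.2) := by
    funext z; rfl
  rw [e]
  exact hcomp.const_smul (μ ^ 2)

/-- **`D` of the blow-up limit at every apex — general scales, local centres, any measurability
radius** (Wang–Zhang 2017, §4 Step 1, (4.3)–(4.4) for `D`; Seregin 2014 Prop. 6.20): the statement
of `blowup_cknD_le_apex_of_tendsto` below with the a.e.-measurability of the original pressure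
required only on `Q(z₀, ρ₀)` for SOME `ρ₀ > 0` (for an apex `z₀ = (T, x₀)` of a solution living on
`(0, T) × ℝ³` take `ρ₀² ≤ T`). [cite: WangZhang2016, §4 Step 1 (4.3)–(4.4)] [cite: Seregin2014, §6.6 Prop. 6.20] -/
theorem blowup_cknD_le_apex_of_tendsto_of_radius {z₀ : ℝ × EuclideanSpace ℝ (Fin 3)} {ρ₀ : ℝ}
    (hρ₀ : 0 < ρ₀)
    (hpm : AEStronglyMeasurable (uncurry p) (volume.restrict (parabolicCylinder ρ₀ z₀)))
    {K : ℝ≥0∞} {τ r₁ ρ : ℝ} (hτ : 0 < τ) (hr₁ : 0 < r₁) (hρ : 0 < ρ)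
    (hK : ∀ z : ℝ × EuclideanSpace ℝ (Fin 3), z.1 ≤ z₀.1 → z₀.1 - τ ≤ z.1 → dist z.2 z₀.2 < ρ →
      ∀ r ∈ Ioc (0 : ℝ) r₁, cknD r z p ≤ K)
    {μ : ℕ → ℝ} (hμ : ∀ j, 0 < μ j) (hμ0 : Tendsto μ atTop (𝓝 0))
    {π : ℝ → EuclideanSpace ℝ (Fin 3) → ℝ}
    (hπ : ∀ a : ℝ, 0 < a → MemLp (uncurry π) (3 / 2)
      (volume.restrict (parabolicCylinder a (0 : ℝ × EuclideanSpace ℝ (Fin 3)))))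
    (hweak : ∀ a : ℝ, 0 < a → ∀ g : ℝ × EuclideanSpace ℝ (Fin 3) → ℝ,
      MemLp g 3 (volume.restrict (parabolicCylinder a (0 : ℝ × EuclideanSpace ℝ (Fin 3)))) →
      Tendsto (fun j => ∫ w' in parabolicCylinder a (0 : ℝ × EuclideanSpace ℝ (Fin 3)),
          ((μ j) ^ 2 • stPull ((μ j) ^ 2) (μ j) z₀.1 z₀.2 p) w'.1 w'.2 * g w')
        atTop (𝓝 (∫ w' in parabolicCylinder a (0 : ℝ × EuclideanSpace ℝ (Fin 3)),
          π w'.1 w'.2 * g w')))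
    {z : ℝ × EuclideanSpace ℝ (Fin 3)} (hz : z.1 ≤ 0) {r : ℝ} (hr : 0 < r) :
    cknD r z π ≤ K := by
  -- the cylinder `Q(a)` containing `Q_r(z)`
  set a : ℝ := ‖z.2‖ + r + Real.sqrt (r ^ 2 - z.1) + 1 with ha
  have hapos : 0 < a := by rw [ha]; positivity
  have hsub : parabolicCylinder r z ⊆ parabolicCylinder a (0 : ℝ × EuclideanSpace ℝ (Fin 3)) :=
    parabolicCylinder_subset_origin hz hr
  obtain ⟨j₀, hj₀⟩ := eventually_mul_scale_le hμ0 a hρ₀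
  obtain ⟨j₁, hj₁⟩ := eventually_apex_mem_window_ball hz r hτ hr₁ hρ hμ hμ0 z₀.1 z₀.2
  -- the rescaled pressures, uncurried
  set P : ℕ → ℝ × EuclideanSpace ℝ (Fin 3) → ℝ := fun j =>
    uncurry ((μ j) ^ 2 • stPull ((μ j) ^ 2) (μ j) z₀.1 z₀.2 p) with hP
  have hr2 : (ENNReal.ofReal r ^ 2) ≠ 0 := pow_ne_zero _ ((ENNReal.ofReal_pos.2 hr).ne')
  have hr2' : (ENNReal.ofReal r ^ 2) ≠ ∞ := ENNReal.pow_ne_top ENNReal.ofReal_ne_top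
  -- the bound for the approximants on `Q_r(z)`
  have hPk : ∀ j, max j₀ j₁ ≤ j → ∫⁻ w' in parabolicCylinder r z, ‖P j w'‖ₑ ^ (3 / 2 : ℝ) ≤
      ENNReal.ofReal r ^ 2 * K := by
    intro j hj
    obtain ⟨h1, h2, h3, h4⟩ := hj₁ j (le_trans (le_max_right _ _) hj)
    have hD : cknD r z ((μ j) ^ 2 • stPull ((μ j) ^ 2) (μ j) z₀.1 z₀.2 p) ≤ K := by
      rw [cknD_nsZoom (hμ j) hr z₀.1 z₀.2 z p]
      exact hK _ h1 h2 h3 _ ⟨mul_pos (hμ j) hr, h4⟩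
    rw [cknD] at hD
    exact (ENNReal.inv_mul_le_iff hr2 hr2').1 hD
  have hPm : ∀ j, max j₀ j₁ ≤ j → AEStronglyMeasurable (P j)
      (volume.restrict (parabolicCylinder a (0 : ℝ × EuclideanSpace ℝ (Fin 3)))) := fun j hj =>
    aestronglyMeasurable_uncurry_zoom_pressure_of_radius hpm (hμ j) hapos
      (hj₀ _ (le_trans (le_max_left _ _) hj))
  have hweak' : ∀ g : ℝ × EuclideanSpace ℝ (Fin 3) → ℝ,
      MemLp g 3 (volume.restrict (parabolicCylinder a (0 : ℝ × EuclideanSpace ℝ (Fin 3)))) →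
      Tendsto (fun j => ∫ w' in parabolicCylinder a (0 : ℝ × EuclideanSpace ℝ (Fin 3)),
          P j w' * g w')
        atTop (𝓝 (∫ w' in parabolicCylinder a (0 : ℝ × EuclideanSpace ℝ (Fin 3)),
          uncurry π w' * g w')) :=
    fun g hg => hweak a hapos g hg
  have h := setLIntegral_rpow_threeHalves_le_of_tendsto_weakly
    (isOpen_parabolicCylinder r z).measurableSet hsub (hπ a hapos) hPm hPk hweak'
  rw [cknD]
  exact (ENNReal.inv_mul_le_iff hr2 hr2').2 h

/-- **`D` of the blow-up limit at every apex — general scales, local centres** (Wang–Zhang 2017,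
§4 Step 1, (4.3)–(4.4) for `D`; weak lower semicontinuity of `∫_{Q_r(z)} |·|^{3/2}`, Seregin 2014
Prop. 6.20). Let `μ_j > 0`, `μ_j → 0`, and let the rescaled pressures
`p^{μ_j}(s, y) = μ_j² p(t₀ + μ_j² s, x₀ + μ_j y)` converge weakly in `L^{3/2}(Q(a))` (tested
against `L³(Q(a))`) to `π ∈ L^{3/2}(Q(a))`, for every `a > 0` (the output of
`Seregin2020.exists_ancientLimit` / `exists_zoom_blowup_limit`). If the plain scaled pressure
quantity of the ORIGINAL pressure satisfies `D(r; z) ≤ K` at every apex `z` in the backward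
window `t₀ - τ ≤ z.1 ≤ t₀` WITH CENTRE IN THE BALL `|z.2 - x₀| < ρ` and every radius
`0 < r ≤ r₁`, then `D(r; z)[π] ≤ K` at EVERY apex with `z.1 ≤ 0` and every `r > 0`: the apex
`Φ_{μ_j}(z)` of `Q_{μ_j r}(Φ_{μ_j} z)`, which carries `D(r; z)[p^{μ_j}]` (`cknD_nsZoom`), enters the
window, the ball and the radius range for large `j` (`eventually_apex_mem_window_ball`). This is
the tree's `blowup_cknD_le_apex` with an arbitrary scale sequence and a spatially LOCAL
hypothesis. [cite: WangZhang2016, §4 Step 1 (4.3)–(4.4)] [cite: Seregin2014, §6.6 Prop. 6.20] -/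
theorem blowup_cknD_le_apex_of_tendsto {z₀ : ℝ × EuclideanSpace ℝ (Fin 3)}
    (hpm : AEStronglyMeasurable (uncurry p) (volume.restrict (parabolicCylinder (1 / 2) z₀)))
    {K : ℝ≥0∞} {τ r₁ ρ : ℝ} (hτ : 0 < τ) (hr₁ : 0 < r₁) (hρ : 0 < ρ)
    (hK : ∀ z : ℝ × EuclideanSpace ℝ (Fin 3), z.1 ≤ z₀.1 → z₀.1 - τ ≤ z.1 → dist z.2 z₀.2 < ρ →
      ∀ r ∈ Ioc (0 : ℝ) r₁, cknD r z p ≤ K)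
    {μ : ℕ → ℝ} (hμ : ∀ j, 0 < μ j) (hμ0 : Tendsto μ atTop (𝓝 0))
    {π : ℝ → EuclideanSpace ℝ (Fin 3) → ℝ}
    (hπ : ∀ a : ℝ, 0 < a → MemLp (uncurry π) (3 / 2)
      (volume.restrict (parabolicCylinder a (0 : ℝ × EuclideanSpace ℝ (Fin 3)))))
    (hweak : ∀ a : ℝ, 0 < a → ∀ g : ℝ × EuclideanSpace ℝ (Fin 3) → ℝ,
      MemLp g 3 (volume.restrict (parabolicCylinder a (0 : ℝ × EuclideanSpace ℝ (Fin 3)))) →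
      Tendsto (fun j => ∫ w' in parabolicCylinder a (0 : ℝ × EuclideanSpace ℝ (Fin 3)),
          ((μ j) ^ 2 • stPull ((μ j) ^ 2) (μ j) z₀.1 z₀.2 p) w'.1 w'.2 * g w')
        atTop (𝓝 (∫ w' in parabolicCylinder a (0 : ℝ × EuclideanSpace ℝ (Fin 3)),
          π w'.1 w'.2 * g w')))
    {z : ℝ × EuclideanSpace ℝ (Fin 3)} (hz : z.1 ≤ 0) {r : ℝ} (hr : 0 < r) :
    cknD r z π ≤ K :=
  blowup_cknD_le_apex_of_tendsto_of_radius one_half_pos hpm hτ hr₁ hρ hK hμ hμ0 hπ hweak hz hr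

end Apex

end Literature.Analysis.FluidPDE
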